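import Summits.ValiantsHypothesis.ValiantsHypothesis.Theorems.NcSOSDegreeFour
import HarnessLib

/-!
# Block forms: HWY's lift to degree `4r`, read at degree `4r` (Hrubeš–Wigderson–Yehudayoff §C), 1/3

Workshop file for the node `CommutativityDial` (decomp-valiant lens 6; road K5a′, stage 3a of 3
towards the named fact `HWY10_thm_1_7`), on top of `NcCentralWidth` and `NcSOSDegreeFour`.
§1 FRAMED BODIES (`framed`, `coeff_frame`): the coefficient of the word of `w` in
`c|_{[0,ρ)}·G·c|_{[ρ+e,d)}` (`G` homogeneous of degree `e`) is `[w = c off the window]·[w|_{window}]G`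
— the six cases of HWY's Lemma C.2 in one formula. §2 BLOCK WORDS AND THE BLOCK READING `Λ_r`
(`blockWord`, `blockForm`): positions `Fin (4r)` in four blocks of length `r` carrying the binary
digits of `i, j, i', j' ∈ [2^r]`; `Λ_r f = Σ [blockWord i j i' j']f · x_i y_j x_{i'} y_{j'}` (HWY's
lift `f ↦ f^{(λ)}` composed with the commutative image and its `XYXY` part), and `Λ_r f` as a sum
of products of bilinear forms, straight and twisted (`blockForm_eq_sum(_twist)`). §3 THE LIFTED
IDENTITY POLYNOMIAL `LID_r = Σ_{e ∈ {0,1}^{2r}} z_e z_e` (`lidPoly`): homogeneous of degree `4r`,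
`[blockWord i j i' j'] LID_r = [i = i' ∧ j = j']`, `Λ_r (LID_r) = SOS_{2^r}` (`blockForm_lidPoly`).
HONEST FRAMING: bookkeeping for a theorem in print (HWY, STOC 2010 §C = J. AMS 24 (2011) §5), over
every commutative ring; no lower bound here; Prop. C.3/Cor. C.4 are `NcSOSLift`, Lemma C.5 and
Theorem 1.7 are `NcSOSPermanent`; `VP ≠ VNP` untouched.
-/

noncomputable section

namespace Summit.ValiantsHypothesis.ValiantsHypothesis.Theorems.NcBlockForms

open Literature.Computability.AlgebraicComplexity
open Summit.ValiantsHypothesis.ValiantsHypothesis.Theorems.NcCentralWidth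
open Summit.ValiantsHypothesis.ValiantsHypothesis.Theorems.NcSOSDegreeFour
open MvPolynomial (X)

universe u v

section Frame

variable {R : Type u} [CommSemiring R] {σ : Type v}

/-- The FRAMED BODY `c|_{[0,ρ)} · G · c|_{[ρ+e,d)}` of a context word `c : Fin d → σ` around the
window `[ρ, ρ+e)`. [cite: HrubesWigdersonYehudayoff2010, §A, Lemma C.2] -/
def framed {d ρ e : ℕ} (hρe : ρ + e ≤ d) (c : Fin d → σ) (G : FreeAlgebra R σ) : FreeAlgebra R σ :=
  ((List.ofFn fun q : Fin ρ => c ⟨q.val, by have := q.isLt; omega⟩).map (FreeAlgebra.ι R)).prod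
    * G * ((List.ofFn fun q : Fin (d - (ρ + e)) =>
      c ⟨ρ + e + q.val, by have := q.isLt; omega⟩).map (FreeAlgebra.ι R)).prod

/-- The word of a function on `d` positions splits into the windows `[0,ρ)`, `[ρ,ρ+e)`, `[ρ+e,d)`.
[cite: HrubesWigdersonYehudayoff2010, Lemma C.2] -/
theorem ofFn_frame_split {d ρ e : ℕ} (hρe : ρ + e ≤ d) (w : Fin d → σ) :
    List.ofFn w = (List.ofFn fun q : Fin ρ => w ⟨q.val, by have := q.isLt; omega⟩) ++
      (List.ofFn fun q : Fin e => w ⟨ρ + q.val, by have := q.isLt; omega⟩) ++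
      List.ofFn fun q : Fin (d - (ρ + e)) => w ⟨ρ + e + q.val, by have := q.isLt; omega⟩ := by
  apply List.ext_getElem
  · simp only [List.length_append, List.length_ofFn]; omega
  · intro i h₁ h₂; simp only [List.length_append, List.length_ofFn] at h₁ h₂
    simp only [List.getElem_append, List.getElem_ofFn, List.length_append, List.length_ofFn]
    split_ifs <;> exact congrArg w (Fin.ext (by dsimp only <;> omega))

/-- **Coefficient of a framed body**: the coefficient of the word of `w` in
`c|_{[0,ρ)} · G · c|_{[ρ+e,d)}` (`G` homogeneous of degree `e`) is `[w|_{window}] G` if `w = c` off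
the window, and `0` otherwise. [cite: HrubesWigdersonYehudayoff2010, Lemma C.2] -/
theorem coeff_frame [DecidableEq σ] {d ρ e : ℕ} (hρe : ρ + e ≤ d) {G : FreeAlgebra R σ}
    (hG : degPart d e G = G) (c w : Fin d → σ) :
    coeff (List.ofFn w) (framed hρe c G) =
      if (∀ p : Fin d, ¬(ρ ≤ p.val ∧ p.val < ρ + e) → w p = c p) then
        coeff (List.ofFn fun q : Fin e => w ⟨ρ + q.val, by have := q.isLt; omega⟩) G
      else 0 := by
  unfold framed
  set A := (List.ofFn fun q : Fin ρ => c ⟨q.val, by have := q.isLt; omega⟩) with hA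
  set C := (List.ofFn fun q : Fin (d - (ρ + e)) =>
    c ⟨ρ + e + q.val, by have := q.isLt; omega⟩) with hC
  set Wa := (List.ofFn fun q : Fin ρ => w ⟨q.val, by have := q.isLt; omega⟩) with hWa
  set Wb := (List.ofFn fun q : Fin e => w ⟨ρ + q.val, by have := q.isLt; omega⟩) with hWb
  set Wc := (List.ofFn fun q : Fin (d - (ρ + e)) =>
    w ⟨ρ + e + q.val, by have := q.isLt; omega⟩) with hWc
  have hsplit : List.ofFn w = Wa ++ Wb ++ Wc := ofFn_frame_split hρe w
  obtain ⟨hlA, hlC, hlWa⟩ : A.length = ρ ∧ C.length = d - (ρ + e) ∧ Wa.length = ρ :=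
    ⟨by rw [hA, List.length_ofFn], by rw [hC, List.length_ofFn], by rw [hWa, List.length_ofFn]⟩
  have hlWab : (Wa ++ Wb).length = ρ + e := by rw [List.length_append, hlWa, hWb, List.length_ofFn]
  have hαh : degPart d ρ (A.map (FreeAlgebra.ι R)).prod = (A.map (FreeAlgebra.ι R)).prod := by
    rw [degPart_word (show ρ ≤ d by omega) A, if_pos hlA]
  have hωh : degPart d (d - (ρ + e)) (C.map (FreeAlgebra.ι R)).prod =
      (C.map (FreeAlgebra.ι R)).prod := by
    rw [degPart_word (show d - (ρ + e) ≤ d by omega) C, if_pos hlC]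
  have hαG : degPart d (ρ + e) ((A.map (FreeAlgebra.ι R)).prod * G) =
      (A.map (FreeAlgebra.ι R)).prod * G := degPart_mul_of_eq hαh hG hρe
  have h1 := coeff_mul_degPart (d := d) (a := ρ + e) (b := d - (ρ + e)) (by omega) (List.ofFn w)
    (by rw [List.length_ofFn]; omega) ((A.map (FreeAlgebra.ι R)).prod * G) (C.map (FreeAlgebra.ι R)).prod
  rw [hαG, hωh] at h1
  have h2 := coeff_mul_degPart (d := d) (a := ρ) (b := e) hρe ((List.ofFn w).take (ρ + e))
    (by rw [List.length_take, List.length_ofFn]; omega) (A.map (FreeAlgebra.ι R)).prod G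
  rw [hαh, hG] at h2
  rw [h1, h2, hsplit, List.take_left' hlWab, List.drop_left' hlWab, List.take_left' hlWa,
    List.drop_left' hlWa, coeff_word, coeff_word]
  have key : (A = Wa ∧ C = Wc) ↔ ∀ p : Fin d, ¬(ρ ≤ p.val ∧ p.val < ρ + e) → w p = c p := by
    rw [hA, hWa, hC, hWc, List.ofFn_inj, List.ofFn_inj, funext_iff, funext_iff]
    constructor
    · rintro ⟨h₁, h₂⟩ p hp
      by_cases hpρ : p.val < ρ
      · exact (h₁ ⟨p.val, hpρ⟩).symm
      · have hpd := p.isLt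
        have e1 : (⟨ρ + e + (p.val - (ρ + e)), by omega⟩ : Fin d) = p := Fin.ext (by dsimp only; omega)
        have h₃ := h₂ ⟨p.val - (ρ + e), by omega⟩
        simp only [e1] at h₃; exact h₃.symm
    · intro h
      exact ⟨fun q => (h ⟨q.val, by have := q.isLt; omega⟩
          (by have := q.isLt; dsimp only; omega)).symm,
        fun q => (h ⟨ρ + e + q.val, by have := q.isLt; omega⟩ (by dsimp only; omega)).symm⟩
  by_cases H : A = Wa ∧ C = Wc
  · rw [if_pos H.1, if_pos H.2, if_pos (key.1 H), one_mul, mul_one]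
  · rw [if_neg (fun h => H (key.2 h))]; rcases not_and_or.1 H with h | h
    exacts [by rw [if_neg h, zero_mul, zero_mul], by rw [if_neg h, mul_zero]]

end Frame

section Block

variable (F : Type u) [CommRing F]

/-- The BLOCK WORD of `(i, j, i', j')`: position `p ∈ [4r]` carries the `(p mod r)`-th binary digit
(`finFunctionFinEquiv`) of `i` (block `[0,r)`), `j` (`[r,2r)`), `i'` (`[2r,3r)`), `j'` (`[3r,4r)`).
[cite: HrubesWigdersonYehudayoff2010, §C (the lift `x_i ↦ z_{i_1}⋯z_{i_r}`)] -/
def blockWord (r : ℕ) (i j i' j' : Fin (2 ^ r)) (p : Fin (4 * r)) : Fin 2 :=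
  if h₀ : p.val < r then finFunctionFinEquiv.symm i ⟨p.val, h₀⟩
  else if h₁ : p.val < 2 * r then finFunctionFinEquiv.symm j ⟨p.val - r, by omega⟩
  else if h₂ : p.val < 3 * r then finFunctionFinEquiv.symm i' ⟨p.val - 2 * r, by omega⟩
  else finFunctionFinEquiv.symm j' ⟨p.val - 3 * r, by have := p.isLt; omega⟩

/-- Two block words agree at a position as soon as the indices of the block of that position agree.
[cite: HrubesWigdersonYehudayoff2010, §C] -/
theorem blockWord_eq (r : ℕ) (i j i' j' x y x' y' : Fin (2 ^ r)) (p : Fin (4 * r))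
    (h₀ : p.val < r → i = x) (h₁ : r ≤ p.val → p.val < 2 * r → j = y)
    (h₂ : 2 * r ≤ p.val → p.val < 3 * r → i' = x') (h₃ : 3 * r ≤ p.val → j' = y') :
    blockWord r i j i' j' p = blockWord r x y x' y' p := by
  unfold blockWord; split_ifs with g₀ g₁ g₂
  exacts [by rw [h₀ g₀], by rw [h₁ (by omega) g₁], by rw [h₂ (by omega) g₂], by rw [h₃ (by omega)]]

/-- Block `[0,r)` reads `i`, `[r,2r)` reads `j`, `[2r,3r)` reads `i'`, `[3r,4r)` reads `j'`.
[cite: HrubesWigdersonYehudayoff2010, §C] -/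
theorem blockWord_at (r : ℕ) (i j i' j' : Fin (2 ^ r)) (p : Fin (4 * r)) (o : Fin r) :
    (p.val = o.val → blockWord r i j i' j' p = finFunctionFinEquiv.symm i o) ∧
    (p.val = r + o.val → blockWord r i j i' j' p = finFunctionFinEquiv.symm j o) ∧
    (p.val = 2 * r + o.val → blockWord r i j i' j' p = finFunctionFinEquiv.symm i' o) ∧
    (p.val = 3 * r + o.val → blockWord r i j i' j' p = finFunctionFinEquiv.symm j' o) := by
  unfold blockWord
  have := o.isLt
  refine ⟨fun hp => ?_, fun hp => ?_, fun hp => ?_, fun hp => ?_⟩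
  · rw [dif_pos (by omega)]; exact congrArg _ (Fin.ext hp)
  · rw [dif_neg (by omega), dif_pos (by omega)]
    exact congrArg _ (Fin.ext (by dsimp only; omega))
  · rw [dif_neg (by omega), dif_neg (by omega), dif_pos (by omega)]
    exact congrArg _ (Fin.ext (by dsimp only; omega))
  · rw [dif_neg (by omega), dif_neg (by omega), dif_neg (by omega)]
    exact congrArg _ (Fin.ext (by dsimp only; omega))

/-- A position of the second half reads, in the word whose SECOND half carries `(i, j)`, what the
position `2r` earlier reads in the word whose FIRST half carries `(i, j)`.
[cite: HrubesWigdersonYehudayoff2010, §C] -/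
theorem blockWord_shift (r : ℕ) (i j x y x' y' : Fin (2 ^ r)) (p q : Fin (4 * r))
    (hq : q.val + 2 * r = p.val) : blockWord r i j x' y' q = blockWord r x y i j p := by
  unfold blockWord
  have h4 := p.isLt; by_cases g : p.val < 3 * r
  · rw [dif_pos (by omega), dif_neg (by omega), dif_neg (by omega), dif_pos g]
    exact congrArg _ (Fin.ext (by dsimp only; omega))
  · rw [dif_neg (by omega), dif_pos (by omega), dif_neg (by omega), dif_neg (by omega), dif_neg g]
    exact congrArg _ (Fin.ext (by dsimp only; omega))

/-- The BLOCK READING `Λ_r : f ↦ Σ_{i,j,i',j'} [blockWord i j i' j'] f · x_i y_j x_{i'} y_{j'}`.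
[cite: HrubesWigdersonYehudayoff2010, Cor. C.4 (proof)] -/
def blockForm (r : ℕ) :
    FreeAlgebra F (Fin 2) →ₗ[F] MvPolynomial (Fin (2 ^ r) ⊕ Fin (2 ^ r)) F :=
  ∑ i : Fin (2 ^ r), ∑ j : Fin (2 ^ r), ∑ i' : Fin (2 ^ r), ∑ j' : Fin (2 ^ r),
    (coeff (List.ofFn (blockWord r i j i' j'))).smulRight
      (X (Sum.inl i) * X (Sum.inr j) * (X (Sum.inl i') * X (Sum.inr j')))

/-- `Λ_r` unfolded. [cite: HrubesWigdersonYehudayoff2010, Cor. C.4] -/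
theorem blockForm_apply (r : ℕ) (f : FreeAlgebra F (Fin 2)) :
    blockForm F r f = ∑ i : Fin (2 ^ r), ∑ j : Fin (2 ^ r), ∑ i' : Fin (2 ^ r), ∑ j' : Fin (2 ^ r),
      coeff (List.ofFn (blockWord r i j i' j')) f •
        (X (Sum.inl i) * X (Sum.inr j) * (X (Sum.inl i') * X (Sum.inr j')) :
          MvPolynomial (Fin (2 ^ r) ⊕ Fin (2 ^ r)) F) := by
  simp only [blockForm, LinearMap.sum_apply, LinearMap.smulRight_apply]

/-- Moving an outer summation inside a fourfold sum. [cite: HrubesWigdersonYehudayoff2010, Prop. B.1] -/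
theorem sum5_comm {M : Type*} [AddCommMonoid M] {ι : Type*} (T : Finset ι) {k : ℕ}
    (g : ι → Fin k → Fin k → Fin k → Fin k → M) :
    (∑ t ∈ T, ∑ i, ∑ j, ∑ i', ∑ j', g t i j i' j') = ∑ i, ∑ j, ∑ i', ∑ j', ∑ t ∈ T, g t i j i' j' :=
  Finset.sum_comm.trans <| Finset.sum_congr rfl fun _ _ => Finset.sum_comm.trans <|
    Finset.sum_congr rfl fun _ _ => Finset.sum_comm.trans <|
      Finset.sum_congr rfl fun _ _ => Finset.sum_comm

/-- **`Λ_r f` as a sum of products of bilinear forms, straight form**: if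
`[blockWord i j i' j'] f = Σ_t a_t(i,j) b_t(i',j')` then `Λ_r f = Σ_t a_t(X,Y) · b_t(X,Y)`.
[cite: HrubesWigdersonYehudayoff2010, Prop. B.1, Cor. C.4] -/
theorem blockForm_eq_sum (r : ℕ) {ι : Type*} (T : Finset ι) {f : FreeAlgebra F (Fin 2)}
    {a b : ι → Fin (2 ^ r) → Fin (2 ^ r) → F}
    (hc : ∀ i j i' j', coeff (List.ofFn (blockWord r i j i' j')) f = ∑ t ∈ T, a t i j * b t i' j') :
    blockForm F r f = ∑ t ∈ T, HWY10.bilinForm F (a t) * HWY10.bilinForm F (b t) := by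
  rw [blockForm_apply]; simp only [bilinForm_mul_bilinForm]; rw [sum5_comm]
  refine Finset.sum_congr rfl fun i _ => Finset.sum_congr rfl fun j _ =>
    Finset.sum_congr rfl fun i' _ => Finset.sum_congr rfl fun j' _ => ?_
  rw [hc, Finset.sum_smul]

/-- **`Λ_r f` as a sum of products of bilinear forms, twisted form**: if
`[blockWord i j i' j'] f = Σ_t a_t(i,j') b_t(i',j)` then `Λ_r f = Σ_t a_t(X,Y) · b_t(X,Y)`
(commutativity of the target exchanges `y_j` and `y_{j'}`).
[cite: HrubesWigdersonYehudayoff2010, Prop. B.1, Cor. C.4] -/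
theorem blockForm_eq_sum_twist (r : ℕ) {ι : Type*} (T : Finset ι) {f : FreeAlgebra F (Fin 2)}
    {a b : ι → Fin (2 ^ r) → Fin (2 ^ r) → F}
    (hc : ∀ i j i' j', coeff (List.ofFn (blockWord r i j i' j')) f = ∑ t ∈ T, a t i j' * b t i' j) :
    blockForm F r f = ∑ t ∈ T, HWY10.bilinForm F (a t) * HWY10.bilinForm F (b t) := by
  rw [blockForm_apply]; simp only [bilinForm_mul_bilinForm]; rw [sum5_comm, sum4_swap24]
  refine Finset.sum_congr rfl fun i _ => Finset.sum_congr rfl fun j _ =>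
    Finset.sum_congr rfl fun i' _ => Finset.sum_congr rfl fun j' _ => ?_
  rw [hc, Finset.sum_smul]
  exact Finset.sum_congr rfl fun t _ => by simp only [MvPolynomial.smul_eq_C_mul, map_mul]; ring

/-- `LID_r = Σ_{e ∈ {0,1}^{2r}} z_e z_e`: the sum of the `2r`-PERIODIC words of length `4r` over
`{z₀, z₁}` — the lift of `ID_{2^r} = Σ_{i,j} x_i y_j x_i y_j`. [cite: HrubesWigdersonYehudayoff2010, Cor. C.4] -/
def lidPoly (r : ℕ) : FreeAlgebra F (Fin 2) :=
  ∑ e : Fin (2 * r) → Fin 2, ((List.ofFn fun p : Fin (4 * r) =>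
    e ⟨p.val % (2 * r), Nat.mod_lt _ (by have := p.isLt; omega)⟩).map (FreeAlgebra.ι F)).prod

/-- `LID_r` is homogeneous of degree `4r`. [cite: HrubesWigdersonYehudayoff2010, Cor. C.4] -/
theorem degPart_lidPoly (r : ℕ) : degPart (4 * r) (4 * r) (lidPoly F r) = lidPoly F r := by
  unfold lidPoly; rw [map_sum]
  exact Finset.sum_congr rfl fun e _ => by rw [degPart_word le_rfl, if_pos (by simp)]

/-- A periodic word is a block word exactly when the block word has equal halves, and then it is the
period of that block word. [cite: HrubesWigdersonYehudayoff2010, Cor. C.4] -/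
theorem periodic_eq_blockWord_iff (r : ℕ) (i j i' j' : Fin (2 ^ r)) (e : Fin (2 * r) → Fin 2) :
    (fun p : Fin (4 * r) => e ⟨p.val % (2 * r), Nat.mod_lt _ (by have := p.isLt; omega)⟩) =
        blockWord r i j i' j' ↔
      (i = i' ∧ j = j') ∧ e = fun q => blockWord r i j i' j' ⟨q.val, by have := q.isLt; omega⟩ := by
  constructor
  · intro H
    have Hp : ∀ p : Fin (4 * r), e ⟨p.val % (2 * r), Nat.mod_lt _ (by have := p.isLt; omega)⟩ =
        blockWord r i j i' j' p := fun p => congrFun H p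
    have He : ∀ p q : Fin (4 * r), q.val + 2 * r = p.val →
        blockWord r i j i' j' q = blockWord r i j i' j' p := by
      intro p q hq; rw [← Hp p, ← Hp q]
      exact congrArg e (Fin.ext (by dsimp only; rw [← hq, Nat.add_mod_right]))
    refine ⟨⟨?_, ?_⟩, ?_⟩
    · apply finFunctionFinEquiv.symm.injective; funext o; have ho := o.isLt
      rw [← (blockWord_at r i j i' j' ⟨o.val, by omega⟩ o).1 rfl,
        ← (blockWord_at r i j i' j' ⟨2 * r + o.val, by omega⟩ o).2.2.1 rfl]
      exact He _ _ (by dsimp only; omega)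
    · apply finFunctionFinEquiv.symm.injective; funext o; have ho := o.isLt
      rw [← (blockWord_at r i j i' j' ⟨r + o.val, by omega⟩ o).2.1 rfl,
        ← (blockWord_at r i j i' j' ⟨3 * r + o.val, by omega⟩ o).2.2.2 rfl]
      exact He _ _ (by dsimp only; omega)
    · funext q; have hq := q.isLt
      rw [← Hp ⟨q.val, by omega⟩]
      exact congrArg e (Fin.ext (by dsimp only; rw [Nat.mod_eq_of_lt hq]))
  · rintro ⟨⟨rfl, rfl⟩, rfl⟩
    funext p; have h4 := p.isLt; dsimp only
    by_cases hp : p.val < 2 * r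
    · exact congrArg _ (Fin.ext (by dsimp only; rw [Nat.mod_eq_of_lt hp]))
    · rw [← blockWord_shift r i j i j i j p ⟨p.val - 2 * r, by omega⟩ (by dsimp only; omega)]
      exact congrArg _ (Fin.ext (by
        dsimp only; rw [Nat.mod_eq_sub_mod (by omega), Nat.mod_eq_of_lt (by omega)]))

/-- **The block coefficients of `LID_r`**: `[blockWord i j i' j'] LID_r = [i = i' ∧ j = j']`.
[cite: HrubesWigdersonYehudayoff2010, Cor. C.4] -/
theorem coeff_blockWord_lidPoly (r : ℕ) (i j i' j' : Fin (2 ^ r)) :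
    coeff (List.ofFn (blockWord r i j i' j')) (lidPoly F r) =
      if i = i' ∧ j = j' then (1 : F) else 0 := by
  classical
  unfold lidPoly; rw [map_sum]; simp only [coeff_word, List.ofFn_inj, periodic_eq_blockWord_iff]
  by_cases h : i = i' ∧ j = j'
  · rw [if_pos h, Finset.sum_eq_single (fun q : Fin (2 * r) =>
      blockWord r i j i' j' ⟨q.val, by have := q.isLt; omega⟩)]
    · rw [if_pos ⟨h, rfl⟩]
    · exact fun e _ hne => if_neg fun H => hne H.2
    · exact fun h' => absurd (Finset.mem_univ _) h'
  · rw [if_neg h]; exact Finset.sum_eq_zero fun e _ => if_neg fun H => h H.1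

/-- **`Λ_r (LID_r) = SOS_{2^r}`.** [cite: HrubesWigdersonYehudayoff2010, Cor. C.4] -/
theorem blockForm_lidPoly (r : ℕ) : blockForm F r (lidPoly F r) = HWY10.sosPoly F (2 ^ r) := by
  rw [blockForm_apply]; simp only [coeff_blockWord_lidPoly]
  have inner : ∀ i j : Fin (2 ^ r), (∑ i' : Fin (2 ^ r), ∑ j' : Fin (2 ^ r),
      (if i = i' ∧ j = j' then (1 : F) else 0) • (X (Sum.inl i) * X (Sum.inr j) *
        (X (Sum.inl i') * X (Sum.inr j')) : MvPolynomial (Fin (2 ^ r) ⊕ Fin (2 ^ r)) F)) =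
      X (Sum.inl i) * X (Sum.inr j) * (X (Sum.inl i) * X (Sum.inr j)) := by
    intro i j; rw [Finset.sum_eq_single i, Finset.sum_eq_single j]
    · rw [if_pos ⟨rfl, rfl⟩, one_smul]
    · exact fun j' _ hj' => by rw [if_neg fun h => hj' h.2.symm, zero_smul]
    · exact fun h => absurd (Finset.mem_univ _) h
    · exact fun i' _ hi' => Finset.sum_eq_zero fun j' _ => by
        rw [if_neg fun h => hi' h.1.symm, zero_smul]
    · exact fun h => absurd (Finset.mem_univ _) h
  simp only [inner, HWY10.sosPoly, Finset.sum_mul_sum]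
  exact Finset.sum_congr rfl fun i _ => Finset.sum_congr rfl fun j _ => by ring

end Block

end Summit.ValiantsHypothesis.ValiantsHypothesis.Theorems.NcBlockForms

end
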